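import Summits.NavierStokesRegularity.FunctionalMining.TopEigHeatDanskin
import HarnessLib

/-!
# FunctionalMining / NoGo — K50: THE EXACT EXPONENTS OF ONE FIELD ARE ISOLATED OR EVERYTHING —
# the Danskin integral extends HOLOMORPHICALLY to `Re s > 1`, so the set of exponents `q > 1` at
# which a fixed field is an exact (F2) witness has no accumulation point in `(1, ∞)` unless it is
# all of `(1, ∞)`

Search for candidate a priori estimates; no regularity claim. Cell `pub-nsfunc`, no-go seat
(gen 50, touch 9). Door (b) = (F2) of `NOGO.md` is the WANTED kernel statement
`¬ TopEigHeatCoercivePos q`; an exact witness at `q` is a smooth divergence-free (zero-mean)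
field `v` on `T³` with `Φ_q(v) > 0` and `heatDissipation Φ_q v = 0`. K49 varied the exponent `q`
to first order (log-tilt balance, tangency). This file records the GLOBAL structure in `q`.

Notation: `λ₁ = torusStrainTopEig v ≥ 0` (divergence free), `μ = μ(S(v); S(w))` the Danskin
density `dirTopEig (strainFlat v x) (strainFlat w x)`, `g_w(q) = ∫ q λ₁^{q−1} μ`, so that
`heatDissipation Φ_q v = −g_{Δv}(q)` for real `q ≥ 1` (the tree's Danskin formula
`heatDissipation_topEigMoment_eq_integral`, dictionary seat). The DANSKIN TRANSFORM of the pair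
`(v, w)` is `G_w(s) = ∫ s · λ₁^{s−1} · μ dx` for COMPLEX `s` (principal complex power of the
non-negative real `λ₁`; at strain zeros `0^{s−1} = 0` for `s ≠ 1`).

WHAT IS PROVED (namespace `Summit.NavierStokesRegularity.FunctionalMining.TopEig`, any `d` unless
stated):
1. `hasDerivAt_danskinTransform` — for `v, w` smooth, `v` divergence free and `Re s₀ > 1`, `G_w` is
   complex-differentiable at `s₀` with derivative `∫ (λ₁^{s₀−1} + s₀ λ₁^{s₀−1} log λ₁) μ`
   (`hasDerivAt_integral_of_dominated_loc_of_deriv_le` over `ℂ` on the ball of radius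
   `(Re s₀ − 1)/2`; `‖λ₁^{s−1}‖ = λ₁^{Re s − 1}` and the scalar bounds `l^t ≤ 1 + l^σ`,
   `l^t |log l| ≤ (1 + l^σ)(1/ε + l)`, `0 < ε ≤ t ≤ σ`, give a continuous dominating function).
   Hence `analyticOnNhd_danskinTransform`: **`G_w` is HOLOMORPHIC on the half-plane `{Re s > 1}`**,
   and `danskinTransform_ofReal`: `G_w(q) = g_w(q)` for real `q`.
2. `danskinIntegral_eq_zero_of_frequently` — if `g_w(q) = 0` for `q` in a set accumulating at some
   real `q₀ > 1` (`∃ᶠ q in 𝓝[≠] q₀`), then `g_w(q) = 0` for EVERY real `q > 1` (identity theorem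
   on the connected half-plane, `AnalyticOnNhd.eqOn_zero_of_preconnected_of_frequently_eq_zero`).
3. **`heatDissipation_eq_zero_of_frequently_exact` — EXACT EXPONENTS: ISOLATED OR EVERYTHING.**
   For `v` smooth and divergence free on `T^d` and `q₀ > 1`: if `heatDissipation Φ_q v = 0` for
   `q` in a set accumulating at `q₀`, then `heatDissipation Φ_q v = 0` for every `q > 1`.
   Packaged: `exact_exponents_isolated_or_all` (either `v` is exact at every `q > 1`, or around
   every `q₀ > 1` the exponents `q ≠ q₀` near `q₀` are all non-exact), `exact_all_of_exact_on_Ioo`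
   (exact on an exponent band `(a, b)`, `1 ≤ a < b` ⇒ exact at every `q > 1`;
   `exact_all_of_exact_seq`: the same along a sequence `qₙ → q₀`, `qₙ ≠ q₀`), and on `T³`
   `not_topEigHeatCoercivePos_all_of_exact_on_Ioo` (a zero-mean field exact on a band and with
   `Φ_q(v) > 0` refutes `TopEigHeatCoercivePos q` for EVERY `q > 1` at once).

MEANING FOR THE (F2) SEARCH (design rule, on top of K42–K49):
(R8) EXACTNESS DOES NOT COME IN BANDS. For one design `v` the exact-exponent set
  `E(v) = {q > 1 : heatDissipation Φ_q v = 0}` is closed in `(1, ∞)` (K49, continuity) and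
  DISCRETE there — unless `E(v) = (1, ∞)`, i.e. `v` is a universal exact witness killing L-λ(q)
  for all `q > 1` simultaneously. With K49 (R6): at an ISOLATED exact exponent the violation
  function `q ↦ −heatDissipation Φ_q v ≤ 0` is real-analytic with an isolated zero that is a local
  maximum, hence a zero of finite EVEN order `≥ 2` (prose; the kernel records order one =
  tangency, K49). A search that tunes `q` continuously to keep a fixed design exact is therefore
  chasing either isolated even-order tangencies or a universal witness.
HONEST CAVEAT (design value): structure only — no construction, no exclusion of either branch;
nothing at `q = 1` (the half-plane is `Re s > 1`; K32/K33 own the endpoint); the identity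
theorem needs an accumulation point INSIDE `(1, ∞)`. NOT CLAIMED: any node of the dictionary, any
value of `C_λ(q)`, Navier–Stokes regularity. L-λ(q) stays OPEN for every real `q > 1`. [ours]
FILING (prove seat g29, REQUEST #76): declarations byte-identical to the no-go seat's staged `TopEigHeatExactExponents.STAGING.lean` 07786dcff39a9c9d; this line is the only addition (cut from the v2 docstring-only restage).
-/

noncomputable section

open MeasureTheory Set Filter Topology Metric

namespace Summit.NavierStokesRegularity.FunctionalMining

open Literature.Analysis.FunctionSpaces

namespace TopEig

variable {d : Type*} [Fintype d] [DecidableEq d] [Nonempty d]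

/-! ## 1. Scalar bounds: the modulus of the complex power and of its `s`-derivative -/

/-- `l^t ≤ 1 + l^σ` for `0 ≤ l`, `0 ≤ t ≤ σ` (private copy of K49's bound). [folklore] -/
private theorem rpow_le_one_add_rpow_c {l t σ : ℝ} (hl : 0 ≤ l) (ht : 0 ≤ t) (hσ : t ≤ σ) :
    l ^ t ≤ 1 + l ^ σ := by
  have h0 : 0 ≤ l ^ σ := Real.rpow_nonneg hl σ
  rcases le_or_gt l 1 with h | h
  · have h1 : l ^ t ≤ 1 := Real.rpow_le_one hl h ht
    linarith
  · have h1 : l ^ t ≤ l ^ σ := Real.rpow_le_rpow_of_exponent_le h.le hσ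
    linarith

/-- `l^t · |log l| ≤ (1 + l^σ)(1/ε + l)` for `0 < l`, `0 < ε ≤ t ≤ σ` (private copy). [folklore] -/
private theorem rpow_mul_abs_log_le_c {l t σ ε : ℝ} (hl : 0 < l) (hε : 0 < ε) (ht : ε ≤ t)
    (hσ : t ≤ σ) : l ^ t * |Real.log l| ≤ (1 + l ^ σ) * (1 / ε + l) := by
  have h0 : 0 ≤ l ^ σ := Real.rpow_nonneg hl.le σ
  have hε' : 0 < 1 / ε := one_div_pos.mpr hε
  rcases le_or_gt l 1 with h1 | h1
  · have hA : l ^ t = l ^ (t - ε) * l ^ ε := by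
      rw [← Real.rpow_add hl]; ring_nf
    have hB : l ^ (t - ε) ≤ 1 := Real.rpow_le_one hl.le h1 (by linarith)
    have hC : |Real.log l * l ^ ε| < 1 / ε := Real.abs_log_mul_self_rpow_lt l ε hl h1 hε
    rw [abs_mul, abs_of_nonneg (Real.rpow_nonneg hl.le ε)] at hC
    have hC' : l ^ ε * |Real.log l| ≤ 1 / ε := by rw [mul_comm]; exact hC.le
    calc l ^ t * |Real.log l| = l ^ (t - ε) * (l ^ ε * |Real.log l|) := by rw [hA]; ring
      _ ≤ 1 * (1 / ε) := mul_le_mul hB hC' (by positivity) zero_le_one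
      _ ≤ (1 + l ^ σ) * (1 / ε + l) := by nlinarith
  · have hA : l ^ t ≤ l ^ σ := Real.rpow_le_rpow_of_exponent_le h1.le hσ
    have hB : |Real.log l| ≤ l := by
      rw [abs_of_nonneg (Real.log_nonneg h1.le)]
      linarith [Real.log_le_sub_one_of_pos hl]
    calc l ^ t * |Real.log l| ≤ l ^ σ * l := mul_le_mul hA hB (abs_nonneg _) h0
      _ ≤ (1 + l ^ σ) * (1 / ε + l) := by nlinarith

/-- `‖l^z‖ ≤ 1 + l^σ` for real `l ≥ 0` and complex `z` with `0 < ε ≤ Re z ≤ σ` (principal power;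
`‖l^z‖ = l^{Re z}`). [folklore] -/
theorem norm_cpow_le_one_add_rpow {l ε σ : ℝ} (hl : 0 ≤ l) {z : ℂ} (hε : 0 < ε) (hz : ε ≤ z.re)
    (hσ : z.re ≤ σ) : ‖(l : ℂ) ^ z‖ ≤ 1 + l ^ σ := by
  rw [Complex.norm_cpow_eq_rpow_re_of_nonneg hl (by linarith : z.re ≠ 0)]
  exact rpow_le_one_add_rpow_c hl (hε.le.trans hz) hσ

/-- `‖l^z · log l‖ ≤ (1 + l^σ)(1/ε + l)` for real `l ≥ 0` and `0 < ε ≤ Re z ≤ σ` (`log 0 = 0`).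
[folklore] -/
theorem norm_cpow_mul_log_le {l ε σ : ℝ} (hl : 0 ≤ l) {z : ℂ} (hε : 0 < ε) (hz : ε ≤ z.re)
    (hσ : z.re ≤ σ) : ‖(l : ℂ) ^ z * Complex.log l‖ ≤ (1 + l ^ σ) * (1 / ε + l) := by
  rcases hl.eq_or_lt with h0 | hpos
  · rw [← h0, Complex.ofReal_zero, Complex.log_zero, mul_zero, norm_zero]
    have : 0 ≤ (0:ℝ) ^ σ := Real.rpow_nonneg le_rfl σ
    positivity
  · rw [norm_mul, Complex.norm_cpow_eq_rpow_re_of_pos hpos, ← Complex.ofReal_log hl,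
      Complex.norm_real, Real.norm_eq_abs]
    exact rpow_mul_abs_log_le_c hpos hε hz hσ

/-- The dominating bound for the `s`-derivative of the transform density: for real `l ≥ 0`,
`0 < ε ≤ Re z ≤ σ`, `‖s‖ ≤ Q` and `|m| ≤ M`,
`‖(l^z + s l^z log l) m‖ ≤ (1 + l^σ)(1 + Q(1/ε + l)) M`. [folklore] -/
theorem norm_cpowDeriv_density_le {l m ε σ Q M : ℝ} (hl : 0 ≤ l) {z s : ℂ} (hε : 0 < ε)
    (hz : ε ≤ z.re) (hσ : z.re ≤ σ) (hQ : ‖s‖ ≤ Q) (hm : |m| ≤ M) :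
    ‖((l : ℂ) ^ z + s * ((l : ℂ) ^ z * Complex.log l)) * (m : ℂ)‖ ≤
      (1 + l ^ σ) * (1 + Q * (1 / ε + l)) * M := by
  have h1 := norm_cpow_le_one_add_rpow hl hε hz hσ
  have h2 := norm_cpow_mul_log_le hl hε hz hσ
  have hl' : 0 ≤ 1 + l ^ σ := by positivity
  have hA : ‖(l : ℂ) ^ z + s * ((l : ℂ) ^ z * Complex.log l)‖ ≤
      (1 + l ^ σ) * (1 + Q * (1 / ε + l)) := by
    calc ‖(l : ℂ) ^ z + s * ((l : ℂ) ^ z * Complex.log l)‖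
        ≤ ‖(l : ℂ) ^ z‖ + ‖s‖ * ‖(l : ℂ) ^ z * Complex.log l‖ := by
          rw [← norm_mul]; exact norm_add_le _ _
      _ ≤ (1 + l ^ σ) + Q * ((1 + l ^ σ) * (1 / ε + l)) :=
          add_le_add h1 (mul_le_mul hQ h2 (norm_nonneg _) ((norm_nonneg s).trans hQ))
      _ = (1 + l ^ σ) * (1 + Q * (1 / ε + l)) := by ring
  rw [norm_mul, Complex.norm_real, Real.norm_eq_abs]
  exact mul_le_mul hA hm (abs_nonneg m) ((norm_nonneg _).trans hA)

/-! ## 2. The pointwise `s`-derivative of the transform density -/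

/-- For real `l ≥ 0`, `m`, and complex `s` with `Re s > 1`, `z ↦ z · l^{z−1} · m` has complex
derivative `(l^{s−1} + s l^{s−1} log l) m` at `s` (for `l = 0` the function vanishes identically on
`{Re z > 1}`, and so does the stated derivative). [folklore] -/
theorem hasDerivAt_cpow_density {l m : ℝ} (hl : 0 ≤ l) {s : ℂ} (hs : 1 < s.re) :
    HasDerivAt (fun z : ℂ => z * (l : ℂ) ^ (z - 1) * (m : ℂ))
      (((l : ℂ) ^ (s - 1) + s * ((l : ℂ) ^ (s - 1) * Complex.log l)) * (m : ℂ)) s := by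
  have hne : ∀ z : ℂ, 1 < z.re → z - 1 ≠ 0 := fun z hz h => by
    have h' := congrArg Complex.re h
    simp only [Complex.sub_re, Complex.one_re, Complex.zero_re] at h'
    linarith
  rcases hl.eq_or_lt with h0 | hpos
  · have hz : ((l : ℂ)) ^ (s - 1) = 0 := by
      rw [← h0, Complex.ofReal_zero]; exact Complex.zero_cpow (hne s hs)
    have h : (fun z : ℂ => z * (l : ℂ) ^ (z - 1) * (m : ℂ)) =ᶠ[𝓝 s] fun _ => 0 := by
      filter_upwards [(isOpen_lt continuous_const Complex.continuous_re).mem_nhds hs] with z hz'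
      rw [← h0, Complex.ofReal_zero, Complex.zero_cpow (hne z hz'), mul_zero, zero_mul]
    simpa only [hz, zero_mul, mul_zero, add_zero] using
      (hasDerivAt_const s (0:ℂ)).congr_of_eventuallyEq h
  · have hl0 : (l : ℂ) ≠ 0 := Complex.ofReal_ne_zero.mpr hpos.ne'
    have h : HasDerivAt (fun z : ℂ => (l : ℂ) ^ (z - 1)) ((l : ℂ) ^ (s - 1) * Complex.log l) s := by
      have h := ((hasDerivAt_id s).sub_const 1).const_cpow (c := (l : ℂ)) (Or.inl hl0)
      simp only [id, mul_one] at h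
      exact h
    simpa using ((hasDerivAt_id s).mul h).mul_const (m : ℂ)

/-! ## 3. The Danskin transform is holomorphic on `Re s > 1` -/

/-- **The Danskin transform is complex-differentiable.** For `v, w` smooth on `T^d`, `v` divergence
free, and `Re s₀ > 1`: `s ↦ G_w(s) = ∫ s λ₁^{s−1} μ(S(v); S(w))` has derivative
`∫ (λ₁^{s₀−1} + s₀ λ₁^{s₀−1} log λ₁) μ` at `s₀`. [ours] -/
theorem hasDerivAt_danskinTransform {s₀ : ℂ} (hs₀ : 1 < s₀.re)
    {v w : UnitAddTorus d → EuclideanSpace ℝ d} (hv : Torus.IsSmooth v) (hw : Torus.IsSmooth w)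
    (hdiv : Torus.IsDivFree v) :
    HasDerivAt (fun s : ℂ => ∫ x, s * (torusStrainTopEig v x : ℂ) ^ (s - 1) *
        (dirTopEig (StrainL4.strainFlat v x) (StrainL4.strainFlat w x) : ℂ))
      (∫ x, ((torusStrainTopEig v x : ℂ) ^ (s₀ - 1) + s₀ * ((torusStrainTopEig v x : ℂ) ^ (s₀ - 1) *
        Complex.log (torusStrainTopEig v x))) *
        (dirTopEig (StrainL4.strainFlat v x) (StrainL4.strainFlat w x) : ℂ)) s₀ := by
  set ε : ℝ := (s₀.re - 1) / 2 with hε_def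
  have hε : 0 < ε := by rw [hε_def]; linarith
  have hlam : Continuous fun x => torusStrainTopEig v x := continuous_torusStrainTopEig hv
  have hl0 : ∀ x, 0 ≤ torusStrainTopEig v x := fun x => by
    rw [← lam_strainFlat]; exact lam_strainFlat_nonneg hv hdiv x
  have hμ : AEStronglyMeasurable
      (fun x => dirTopEig (StrainL4.strainFlat v x) (StrainL4.strainFlat w x)) volume := by
    simpa using aestronglyMeasurable_danskinDensity (q := 1) le_rfl hv hw
  have hμC : AEStronglyMeasurable
      (fun x => (dirTopEig (StrainL4.strainFlat v x) (StrainL4.strainFlat w x) : ℂ)) volume :=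
    Complex.continuous_ofReal.comp_aestronglyMeasurable hμ
  have hre : ∀ s : ℂ, (s - 1).re = s.re - 1 := fun s => by simp
  have hc : ∀ s : ℂ, 1 < s.re → Continuous fun x => (torusStrainTopEig v x : ℂ) ^ (s - 1) :=
    fun s hs => (Complex.continuous_ofReal_cpow_const (by rw [hre]; linarith)).comp hlam
  have hlog : Measurable fun x => Complex.log (torusStrainTopEig v x) :=
    Complex.measurable_log.comp (Complex.measurable_ofReal.comp hlam.measurable)
  have hball : ∀ s ∈ ball s₀ ε,
      1 < s.re ∧ ε ≤ (s - 1).re ∧ (s - 1).re ≤ s₀.re - 1 + ε ∧ ‖s‖ ≤ ‖s₀‖ + ε := by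
    intro s hs
    rw [mem_ball, dist_eq_norm] at hs
    have h1 : |(s - s₀).re| ≤ ‖s - s₀‖ := Complex.abs_re_le_norm _
    rw [Complex.sub_re, abs_le] at h1
    obtain ⟨h1a, h1b⟩ := h1
    have h2 : ‖s‖ - ‖s₀‖ ≤ ‖s - s₀‖ := norm_sub_norm_le _ _
    refine ⟨by linarith, by rw [hre]; linarith, by rw [hre]; linarith, by linarith⟩
  have hS : Continuous fun x => ‖StrainL4.strainFlat w x‖ :=
    (StrainL4.continuous_strainFlat hw).norm
  have hpow : ∀ t : ℝ, 0 < t → Continuous fun x => torusStrainTopEig v x ^ t :=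
    fun t ht => hlam.rpow_const fun _ => Or.inr ht.le
  refine (hasDerivAt_integral_of_dominated_loc_of_deriv_le
    (F := fun s x => s * (torusStrainTopEig v x : ℂ) ^ (s - 1) *
      (dirTopEig (StrainL4.strainFlat v x) (StrainL4.strainFlat w x) : ℂ))
    (F' := fun s x => ((torusStrainTopEig v x : ℂ) ^ (s - 1) +
      s * ((torusStrainTopEig v x : ℂ) ^ (s - 1) * Complex.log (torusStrainTopEig v x))) *
      (dirTopEig (StrainL4.strainFlat v x) (StrainL4.strainFlat w x) : ℂ))
    (bound := fun x => (1 + torusStrainTopEig v x ^ (s₀.re - 1 + ε)) *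
      (1 + (‖s₀‖ + ε) * (1 / ε + torusStrainTopEig v x)) * ‖StrainL4.strainFlat w x‖)
    (ball_mem_nhds s₀ hε) ?_ ?_ ?_ ?_ ?_ ?_).2
  · filter_upwards [(isOpen_lt continuous_const Complex.continuous_re).mem_nhds hs₀] with s hs
    exact ((continuous_const.mul (hc s hs)).aestronglyMeasurable).mul hμC
  · refine Integrable.mono'
      (g := fun x => ‖s₀‖ * (1 + torusStrainTopEig v x ^ (s₀.re - 1 + ε)) *
        ‖StrainL4.strainFlat w x‖)
      ((continuous_const.mul (continuous_const.add (hpow _ (by linarith)))).mul hS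
        |>.integrable_unitAddTorus)
      (((continuous_const.mul (hc s₀ hs₀)).aestronglyMeasurable).mul hμC) (ae_of_all _ fun x => ?_)
    have hlx := hl0 x
    have h1 := norm_cpow_le_one_add_rpow hlx (z := s₀ - 1) (σ := s₀.re - 1 + ε) hε
      (by rw [hre]; linarith) (by rw [hre]; linarith)
    rw [norm_mul, norm_mul, Complex.norm_real, Real.norm_eq_abs]
    exact mul_le_mul (mul_le_mul_of_nonneg_left h1 (norm_nonneg _)) (abs_dirTopEig_le_norm _ _)
      (abs_nonneg _) (by positivity)
  · exact ((((hc s₀ hs₀).measurable.add (measurable_const.mul ((hc s₀ hs₀).measurable.mul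
      hlog))).aestronglyMeasurable).mul hμC)
  · refine ae_of_all _ fun x s hs => ?_
    obtain ⟨_, hz, hσ, hQ⟩ := hball s hs
    exact norm_cpowDeriv_density_le (hl0 x) hε hz hσ hQ (abs_dirTopEig_le_norm _ _)
  · exact (((continuous_const.add (hpow _ (by linarith))).mul (continuous_const.add
      (continuous_const.mul (continuous_const.add hlam)))).mul hS).integrable_unitAddTorus
  · exact ae_of_all _ fun x s hs => hasDerivAt_cpow_density (hl0 x) (hball s hs).1

/-- **The Danskin transform is holomorphic on the half-plane `{Re s > 1}`.** [ours] -/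
theorem analyticOnNhd_danskinTransform {v w : UnitAddTorus d → EuclideanSpace ℝ d}
    (hv : Torus.IsSmooth v) (hw : Torus.IsSmooth w) (hdiv : Torus.IsDivFree v) :
    AnalyticOnNhd ℂ (fun s : ℂ => ∫ x, s * (torusStrainTopEig v x : ℂ) ^ (s - 1) *
        (dirTopEig (StrainL4.strainFlat v x) (StrainL4.strainFlat w x) : ℂ)) {s : ℂ | 1 < s.re} :=
  DifferentiableOn.analyticOnNhd
    (fun _ hs =>
      (hasDerivAt_danskinTransform hs hv hw hdiv).differentiableAt.differentiableWithinAt)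
    (isOpen_lt continuous_const Complex.continuous_re)

/-- On the real axis the Danskin transform is the Danskin integral: `G_w(q) = ∫ q λ₁^{q−1} μ` for
real `q` (`λ₁ ≥ 0`, `Complex.ofReal_cpow`). [ours] -/
theorem danskinTransform_ofReal (q : ℝ) {v w : UnitAddTorus d → EuclideanSpace ℝ d}
    (hv : Torus.IsSmooth v) (hdiv : Torus.IsDivFree v) :
    (∫ x, (q : ℂ) * (torusStrainTopEig v x : ℂ) ^ ((q : ℂ) - 1) *
        (dirTopEig (StrainL4.strainFlat v x) (StrainL4.strainFlat w x) : ℂ)) =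
      ((∫ x, q * torusStrainTopEig v x ^ (q - 1) *
        dirTopEig (StrainL4.strainFlat v x) (StrainL4.strainFlat w x) : ℝ) : ℂ) := by
  have hl0 : ∀ x, 0 ≤ torusStrainTopEig v x := fun x => by
    rw [← lam_strainFlat]; exact lam_strainFlat_nonneg hv hdiv x
  have h : ∀ x, (q : ℂ) * (torusStrainTopEig v x : ℂ) ^ ((q : ℂ) - 1) *
      (dirTopEig (StrainL4.strainFlat v x) (StrainL4.strainFlat w x) : ℂ) =
      ((q * torusStrainTopEig v x ^ (q - 1) *
        dirTopEig (StrainL4.strainFlat v x) (StrainL4.strainFlat w x) : ℝ) : ℂ) := fun x => by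
    rw [Complex.ofReal_mul, Complex.ofReal_mul, Complex.ofReal_cpow (hl0 x), Complex.ofReal_sub,
      Complex.ofReal_one]
  simp_rw [h]
  exact integral_ofReal

/-! ## 4. The identity theorem: zeros accumulating inside `(1, ∞)` force identical vanishing -/

/-- If the Danskin integral `g_w(q) = ∫ q λ₁^{q−1} μ(S(v); S(w))` vanishes for `q` in a set of
reals accumulating at some `q₀ > 1`, it vanishes for every real `q > 1` (identity theorem for the
holomorphic transform on the connected half-plane `{Re s > 1}`). [ours] -/
theorem danskinIntegral_eq_zero_of_frequently {q₀ : ℝ} (hq₀ : 1 < q₀)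
    {v w : UnitAddTorus d → EuclideanSpace ℝ d} (hv : Torus.IsSmooth v) (hw : Torus.IsSmooth w)
    (hdiv : Torus.IsDivFree v)
    (hfreq : ∃ᶠ q in 𝓝[≠] q₀, ∫ x, q * torusStrainTopEig v x ^ (q - 1) *
      dirTopEig (StrainL4.strainFlat v x) (StrainL4.strainFlat w x) = 0)
    {q : ℝ} (hq : 1 < q) :
    ∫ x, q * torusStrainTopEig v x ^ (q - 1) *
      dirTopEig (StrainL4.strainFlat v x) (StrainL4.strainFlat w x) = 0 := by
  have hG := analyticOnNhd_danskinTransform hv hw hdiv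
  have hU : IsPreconnected {s : ℂ | 1 < s.re} := (convex_halfSpace_re_gt 1).isPreconnected
  have h0 : (q₀ : ℂ) ∈ {s : ℂ | 1 < s.re} := by simpa using hq₀
  have hT : Tendsto (fun r : ℝ => (r : ℂ)) (𝓝[≠] q₀) (𝓝[≠] (q₀ : ℂ)) :=
    Complex.continuous_ofReal.continuousWithinAt.tendsto_nhdsWithin fun r hr => by
      simpa using hr
  have hfC : ∃ᶠ z in 𝓝[≠] (q₀ : ℂ), (fun s : ℂ => ∫ x, s * (torusStrainTopEig v x : ℂ) ^ (s - 1) *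
      (dirTopEig (StrainL4.strainFlat v x) (StrainL4.strainFlat w x) : ℂ)) z = 0 :=
    hT.frequently (hfreq.mono fun r hr => by
      show (∫ x, (r : ℂ) * (torusStrainTopEig v x : ℂ) ^ ((r : ℂ) - 1) *
        (dirTopEig (StrainL4.strainFlat v x) (StrainL4.strainFlat w x) : ℂ)) = 0
      rw [danskinTransform_ofReal r hv hdiv, hr, Complex.ofReal_zero])
  have hEq := hG.eqOn_zero_of_preconnected_of_frequently_eq_zero hU h0 hfC
  have h1 := hEq (show (q : ℂ) ∈ {s : ℂ | 1 < s.re} by simpa using hq)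
  simp only [Pi.zero_apply] at h1
  rw [danskinTransform_ofReal q hv hdiv] at h1
  exact Complex.ofReal_eq_zero.mp h1

/-- **EXACT EXPONENTS: ISOLATED OR EVERYTHING.** For `v` smooth and divergence free on `T^d` and
`q₀ > 1`: if `heatDissipation Φ_q v = 0` for `q` in a set accumulating at `q₀` (in particular on
a sequence `q_n → q₀`, `q_n ≠ q₀`, or on an interval around `q₀`), then `heatDissipation Φ_q v = 0`
for EVERY real `q > 1`. [ours] -/
theorem heatDissipation_eq_zero_of_frequently_exact {q₀ : ℝ} (hq₀ : 1 < q₀)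
    {v : UnitAddTorus d → EuclideanSpace ℝ d} (hv : Torus.IsSmooth v) (hdiv : Torus.IsDivFree v)
    (hfreq : ∃ᶠ q in 𝓝[≠] q₀, heatDissipation (torusTopEigMoment q) v = 0) {q : ℝ} (hq : 1 < q) :
    heatDissipation (torusTopEigMoment q) v = 0 := by
  have h1 : ∀ᶠ r in 𝓝[≠] q₀, 1 < r := (lt_mem_nhds hq₀).filter_mono nhdsWithin_le_nhds
  have hfreq' : ∃ᶠ r in 𝓝[≠] q₀, ∫ x, r * torusStrainTopEig v x ^ (r - 1) *
      dirTopEig (StrainL4.strainFlat v x) (StrainL4.strainFlat (Torus.laplacian v) x) = 0 :=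
    (hfreq.and_eventually h1).mono fun r hr => by
      have h := hr.1
      rw [heatDissipation_topEigMoment_eq_integral hr.2.le hv hdiv] at h
      exact neg_eq_zero.mp h
  rw [heatDissipation_topEigMoment_eq_integral hq.le hv hdiv,
    danskinIntegral_eq_zero_of_frequently hq₀ hv hv.laplacian hdiv hfreq' hq, neg_zero]

/-- The dichotomy for one field: either `v` is an exact witness at EVERY exponent `q > 1`, or its
exact exponents are isolated in `(1, ∞)` (around every `q₀ > 1`, all `q ≠ q₀` close to `q₀` are
non-exact). [ours] -/
theorem exact_exponents_isolated_or_all {v : UnitAddTorus d → EuclideanSpace ℝ d}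
    (hv : Torus.IsSmooth v) (hdiv : Torus.IsDivFree v) :
    (∀ q : ℝ, 1 < q → heatDissipation (torusTopEigMoment q) v = 0) ∨
      ∀ q₀ : ℝ, 1 < q₀ → ∀ᶠ q in 𝓝[≠] q₀, heatDissipation (torusTopEigMoment q) v ≠ 0 := by
  by_cases h : ∀ q : ℝ, 1 < q → heatDissipation (torusTopEigMoment q) v = 0
  · exact Or.inl h
  · refine Or.inr fun q₀ hq₀ => ?_
    by_contra hne
    have hfreq : ∃ᶠ q in 𝓝[≠] q₀, heatDissipation (torusTopEigMoment q) v = 0 :=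
      (not_eventually.mp hne).mono fun q hq => not_not.mp hq
    exact h fun q hq => heatDissipation_eq_zero_of_frequently_exact hq₀ hv hdiv hfreq hq

/-- Exact on an exponent band ⇒ exact everywhere: if `heatDissipation Φ_q v = 0` for all `q` in an
interval `(a, b)` with `1 ≤ a < b`, then for every `q > 1`. [ours] -/
theorem exact_all_of_exact_on_Ioo {a b : ℝ} (ha : 1 ≤ a) (hab : a < b)
    {v : UnitAddTorus d → EuclideanSpace ℝ d} (hv : Torus.IsSmooth v) (hdiv : Torus.IsDivFree v)
    (h : ∀ q ∈ Set.Ioo a b, heatDissipation (torusTopEigMoment q) v = 0) {q : ℝ} (hq : 1 < q) :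
    heatDissipation (torusTopEigMoment q) v = 0 := by
  have hq₀ : 1 < (a + b) / 2 := by linarith
  have hmem : Set.Ioo a b ∈ 𝓝[≠] ((a + b) / 2) :=
    nhdsWithin_le_nhds (Ioo_mem_nhds (by linarith) (by linarith))
  have hev : ∀ᶠ q in 𝓝[≠] ((a + b) / 2), heatDissipation (torusTopEigMoment q) v = 0 := by
    filter_upwards [hmem] with q hq using h q hq
  exact heatDissipation_eq_zero_of_frequently_exact hq₀ hv hdiv hev.frequently hq

/-- Exact along a sequence of exponents `u n → q₀ > 1`, `u n ≠ q₀` ⇒ exact everywhere on `(1, ∞)`.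
[ours] -/
theorem exact_all_of_exact_seq {q₀ : ℝ} (hq₀ : 1 < q₀) {u : ℕ → ℝ}
    (hu : Tendsto u atTop (𝓝[≠] q₀)) {v : UnitAddTorus d → EuclideanSpace ℝ d}
    (hv : Torus.IsSmooth v) (hdiv : Torus.IsDivFree v)
    (h : ∀ n, heatDissipation (torusTopEigMoment (u n)) v = 0) {q : ℝ} (hq : 1 < q) :
    heatDissipation (torusTopEigMoment q) v = 0 :=
  heatDissipation_eq_zero_of_frequently_exact hq₀ hv hdiv
    (hu.frequently (Eventually.of_forall h).frequently) hq

/-- **(F2) reading on `T³`.** A smooth divergence-free zero-mean field that is an exact witness on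
an exponent band `(a, b)`, `1 ≤ a < b`, refutes `TopEigHeatCoercivePos q` for EVERY `q > 1` with
`Φ_q(v) > 0` — a universal witness. (Contrapositive of (R8): a non-universal design has isolated
exact exponents.) [ours] -/
theorem not_topEigHeatCoercivePos_all_of_exact_on_Ioo {a b : ℝ} (ha : 1 ≤ a) (hab : a < b)
    {v : UnitAddTorus (Fin 3) → EuclideanSpace ℝ (Fin 3)} (hv : Torus.IsSmooth v)
    (hdiv : Torus.IsDivFree v) (hzm : Torus.HasZeroMean v)
    (h : ∀ q ∈ Set.Ioo a b, heatDissipation (torusTopEigMoment q) v = 0) {q : ℝ} (hq : 1 < q)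
    (hΦ : 0 < torusTopEigMoment q v) : ¬ TopEigHeatCoercivePos (d := Fin 3) q := by
  rintro ⟨c, hc, hcoer⟩
  have h1 := hcoer (by simp) v hv hdiv hzm
  rw [exact_all_of_exact_on_Ioo ha hab hv hdiv h hq] at h1
  nlinarith

end TopEig

end Summit.NavierStokesRegularity.FunctionalMining

end

-- search for candidate a priori estimates; no regularity claim
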